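import Literature.Probability.LatticeModels.PolymerGasGeometric

/-!
# `BalabanImbrieJaffe1984to88.BIJ88SupportRegrouping312` — T. Bałaban, J. Imbrie, A. Jaffe, *Effective action and cluster properties of
the abelian Higgs model*, Commun. Math. Phys. **114** (1988) 257–315 [BalabanImbrieJaffe1988]: Sect. 5.14, pp. 310/312 [PDF 54/56] — step 3 of
the derivation of the second display of p. 312: the GENERIC REGROUPING of a sum over sets of supported items (with a product weight and a
component-local constraint) BY THE OVERLAP-CONNECTED COMPONENTS AND THEIR SUPPORTS — the combinatorial content of *"The connected components of
G define a partition … Here W₆^{(k)′}(X) is obtained by summing only over {X_γ}, (Y₁,…,Y_B) which fill X"* (p. 310) and of *"the result can be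
written in the following form … Σ_{{X_{r′}}} Π_{r′} G_k(X_{r′}) … The X_{r′} are disjoint"* (p. 312).

HONEST FRAMING (cell `lit-balaban`, verbatim): statement-level skeleton of published theorems with citation tags; proofs where landed; nothing here is a claim about the Yang–Mills mass gap.

PDF held: `paper:balaban1988-cmp114-bij-abelian-higgs-effective-action` (journal page = PDF page + 256); p. 310 = PDF p. 54, p. 312 = PDF p. 56.

CITATION HEADER (verbatim).  p. 310 [PDF 54]: *"Here ℒ denotes pairs of clusters (lines) and G runs over graphs of such lines in which each Y_δ is
connected directly or indirectly to some X_γ. The connected components of G define a partition of H which corresponds to the partition in the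
formula … Here W₆^{(k)′}(X) is obtained by summing only over {X_γ}, (Y₁,…,Y_B) which fill X"*.  p. 312 [PDF 56]: *"Without going into details,
it is clear that the result can be written in the following form: ⟨Π_{σ₁} F^{m̄}_{k,loc}(X_{σ₁})⟩₁ = Σ_{{X_{r′}}} Π_{r′} G_k(X_{r′}) Π_{c} F^L_{k+1,loc}(X_c).
The X_{r′} are disjoint, and each one covers at least one X_{σ₁}"*.

WHAT IS REPRODUCED (unit `lit-balaban-p25`, generation 11 of the Phase-2 proof seat p25; SKELETON row `C2.Claim@312` (second display) — step 3,
the model-free regrouping lemma; instantiated in `BIJ88ObservableFactorization312`; HOME `run/shared/lean/pub/lit-balaban/lit-balaban-p25/`).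
Setting: items `α` (in the application: decorated polymers X_γ and Mayer support sets) each with a nonempty SUPPORT `isupp v : Finset ι` (a set of
cubes); two items are *adjacent* when their supports OVERLAP (`Ov`); a finite universe `U`; a weight `a : α → M`; a LOCAL constraint `AdmLoc` on
sets of items, imposed on each overlap-connected component (`LatticeModels.rcomponents (Ov isupp)`).
§1 `Ov`, `asupp` (support of a set of items), disjointness of the supports of distinct members of a compatible family
  (`disjoint_asupp_of_compatible`), `rcomponents_sdiff` / `rcomponents_union_of_separated` (removing / adding one component), `asupp_injOn_rcomponents`.
§2 `aggFiber U AdmLoc X` (the connected admissible sets of items with support exactly `X`) and **`aggWeight`** — the activity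
  `G(X) := Σ_{K ⊆ U connected, AdmLoc K, asupp K = X} Π_{v∈K} a v` of the aggregate `X` (p. 310 *"summing only over … which fill X"*); `slice U AdmLoc ρ`
  (the sets of items all of whose components satisfy `AdmLoc` and whose family of component supports is `ρ`).
§3 **`sum_slice_eq_prod_aggWeight`** — for a family `ρ` of pairwise disjoint sets of cubes: `Σ_{V ∈ slice ρ} Π_{v∈V} a v = Π_{X∈ρ} G(X)` (the bijection
  `V ↦ (components, their supports)`; induction on `ρ`, splitting off the component with a given support); `disjFamilies W` (families of pairwise
  disjoint nonempty subsets of `W`), `image_asupp_mem_disjFamilies` (*"The X_{r′} are disjoint"*), and the re-summed form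
  **`sum_admLoc_eq_sum_disjFamilies`**: `Σ_{V ⊆ U: every component admissible, Φ(component supports)} Π a = Σ_{ρ ∈ disjFamilies, Φ ρ} Π_{X∈ρ} G(X)` for
  any constraint `Φ` on the family of supports.
HONEST SCOPE: pure finite combinatorics over a commutative semiring; nothing analytic; 0 `sorry`, 0 new `Prop` facts.
-/

noncomputable section

open Finset
open Literature.Probability.LatticeModels

namespace Literature.MathematicalPhysics.QuantumFieldTheory.BalabanImbrieJaffe1984to88.BIJ88SupportRegrouping312

variable {α : Type*} [DecidableEq α] {ι : Type*} [DecidableEq ι] {M : Type*} [CommSemiring M]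
variable (isupp : α → Finset ι)

/-! ## §1 Items with supports, overlap adjacency, components -/

/-- two items are adjacent when their supports overlap (p. 310 [PDF 54]: *"u(X, Y) = 0 if X, Y overlap"*; the lines `ℒ` of the graphs `G`).
[cite: BalabanImbrieJaffe1988, (5.14.5) p.312] -/
def Ov (v w : α) : Prop := ¬ Disjoint (isupp v) (isupp w)

/-- overlap is decidable. [cite: BalabanImbrieJaffe1988, (5.14.5) p.312] -/
instance instDecidableRelOv : DecidableRel (Ov isupp) := fun v w => inferInstanceAs (Decidable (¬ Disjoint (isupp v) (isupp w)))

/-- the support of a set of items: the set of cubes it fills (p. 310 *"{X_γ}, (Y₁,…,Y_B) which fill X"*). [cite: BalabanImbrieJaffe1988, (5.14.5) p.312] -/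
def asupp (K : Finset α) : Finset ι := K.biUnion isupp

variable {isupp}

omit [DecidableEq α] [DecidableEq ι] in
/-- overlap is symmetric. [cite: BalabanImbrieJaffe1988, (5.14.5) p.312] -/
theorem ov_symm : ∀ v w : α, Ov isupp v w → Ov isupp w v := fun v w h => by
  unfold Ov at h ⊢; rwa [disjoint_comm]

omit [DecidableEq α] in
/-- membership in the support of a set of items. [cite: BalabanImbrieJaffe1988, (5.14.5) p.312] -/
theorem mem_asupp {K : Finset α} {i : ι} : i ∈ asupp isupp K ↔ ∃ v ∈ K, i ∈ isupp v := mem_biUnion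

omit [DecidableEq α] in
/-- `isupp v ⊆ asupp K` for `v ∈ K`. [cite: BalabanImbrieJaffe1988, (5.14.5) p.312] -/
theorem isupp_subset_asupp {K : Finset α} {v : α} (hv : v ∈ K) : isupp v ⊆ asupp isupp K := subset_biUnion_of_mem isupp hv

/-- the support of a union. [cite: BalabanImbrieJaffe1988, (5.14.5) p.312] -/
theorem asupp_union (K K' : Finset α) : asupp isupp (K ∪ K') = asupp isupp K ∪ asupp isupp K' := union_biUnion

omit [DecidableEq α] in
/-- a nonempty set of items with nonempty supports has nonempty support. [cite: BalabanImbrieJaffe1988, (5.14.5) p.312] -/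
theorem asupp_nonempty {K : Finset α} (hK : K.Nonempty) (hne : ∀ v ∈ K, (isupp v).Nonempty) : (asupp isupp K).Nonempty := by
  obtain ⟨v, hv⟩ := hK
  obtain ⟨i, hi⟩ := hne v hv
  exact ⟨i, mem_asupp.2 ⟨v, hv, hi⟩⟩

omit [DecidableEq α] in
/-- two sets of items with no overlapping pair have disjoint supports. [cite: BalabanImbrieJaffe1988, (5.14.5) p.312] -/
theorem disjoint_asupp_of_forall_not_ov {K K' : Finset α} (h : ∀ v ∈ K, ∀ w ∈ K', ¬ Ov isupp v w) :
    Disjoint (asupp isupp K) (asupp isupp K') := by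
  rw [asupp, asupp, disjoint_biUnion_left]
  intro v hv
  rw [disjoint_biUnion_right]
  intro w hw
  have := h v hv w hw
  unfold Ov at this
  exact not_not.1 this

omit [DecidableEq α] in
/-- conversely an item of the one set overlapping an item of the other makes the supports meet. [cite: BalabanImbrieJaffe1988, (5.14.5) p.312] -/
theorem not_disjoint_asupp_of_ov {K K' : Finset α} {v w : α} (hv : v ∈ K) (hw : w ∈ K') (h : Ov isupp v w) :
    ¬ Disjoint (asupp isupp K) (asupp isupp K') := fun hd =>
  h (hd.mono (isupp_subset_asupp hv) (isupp_subset_asupp hw))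

omit [DecidableEq α] [DecidableEq ι] in
/-- distinct members of a `GeomInc (Ov isupp)`-compatible family share no item and have no overlapping items; in particular their supports are
disjoint. [cite: BalabanImbrieJaffe1988, (5.14.5) p.312] -/
theorem forall_not_ov_of_compatible {𝒦 : Finset (Finset α)} (hcomp : IsCompatible (GeomInc (Ov isupp)) 𝒦) {K K' : Finset α} (hK : K ∈ 𝒦)
    (hK' : K' ∈ 𝒦) (hne : K ≠ K') : (∀ v ∈ K, ∀ w ∈ K', v ≠ w ∧ ¬ Ov isupp v w) := by
  intro v hv w hw
  have h := hcomp (mem_coe.2 hK) (mem_coe.2 hK') hne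
  constructor
  · rintro rfl
    exact h (Or.inr ⟨v, hv, v, hw, Or.inl rfl⟩)
  · intro hov
    exact h (Or.inr ⟨v, hv, w, hw, Or.inr hov⟩)

omit [DecidableEq α] [DecidableEq ι] in
/-- distinct members of a compatible family are disjoint as sets of items. [cite: BalabanImbrieJaffe1988, (5.14.5) p.312] -/
theorem disjoint_of_compatible {𝒦 : Finset (Finset α)} (hcomp : IsCompatible (GeomInc (Ov isupp)) 𝒦) {K K' : Finset α} (hK : K ∈ 𝒦)
    (hK' : K' ∈ 𝒦) (hne : K ≠ K') : Disjoint K K' :=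
  disjoint_left.2 fun v hv hv' => (forall_not_ov_of_compatible hcomp hK hK' hne v hv v hv').1 rfl

omit [DecidableEq α] in
/-- distinct members of a compatible family have disjoint supports (*"The X_{r′} are disjoint"*, p. 312). [cite: BalabanImbrieJaffe1988, (5.14.5) p.312] -/
theorem disjoint_asupp_of_compatible {𝒦 : Finset (Finset α)} (hcomp : IsCompatible (GeomInc (Ov isupp)) 𝒦) {K K' : Finset α} (hK : K ∈ 𝒦)
    (hK' : K' ∈ 𝒦) (hne : K ≠ K') : Disjoint (asupp isupp K) (asupp isupp K') :=
  disjoint_asupp_of_forall_not_ov fun v hv w hw => (forall_not_ov_of_compatible hcomp hK hK' hne v hv w hw).2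

omit [DecidableEq ι] in
/-- the components of a set of items form a compatible family of connected sets (tree: `isCompatible_rcomponents`,
`isRConnected_rcomponent`). [cite: BalabanImbrieJaffe1988, (5.14.5) p.312] -/
theorem rcomponents_props (V : Finset α) :
    IsCompatible (GeomInc (Ov isupp)) (rcomponents (Ov isupp) V) ∧ ∀ K ∈ rcomponents (Ov isupp) V, IsRConnected (Ov isupp) K := by
  refine ⟨isCompatible_rcomponents ov_symm V, fun K hK => ?_⟩
  obtain ⟨p, hp, rfl⟩ := mem_rcomponents_iff.1 hK
  exact isRConnected_rcomponent ov_symm hp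

omit [DecidableEq ι] in
/-- members of `rcomponents V` are subsets of `V`. [cite: BalabanImbrieJaffe1988, (5.14.5) p.312] -/
theorem subset_of_mem_rcomponents {V K : Finset α} (hK : K ∈ rcomponents (Ov isupp) V) : K ⊆ V := by
  obtain ⟨p, -, rfl⟩ := mem_rcomponents_iff.1 hK
  exact rcomponent_subset V p

/-- a set of items with nonempty supports injects, through its components, into families of sets with pairwise disjoint nonempty supports:
the support map is injective on the components. [cite: BalabanImbrieJaffe1988, (5.14.5) p.312] -/
theorem asupp_injOn_rcomponents {V : Finset α} (hne : ∀ v ∈ V, (isupp v).Nonempty) :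
    Set.InjOn (asupp isupp) (rcomponents (Ov isupp) V : Set (Finset α)) := by
  intro K hK K' hK' h
  by_contra hKK'
  have hd := disjoint_asupp_of_compatible (rcomponents_props V).1 (mem_coe.1 hK) (mem_coe.1 hK') hKK'
  rw [h, disjoint_self, bot_eq_empty] at hd
  have hK'ne : (asupp isupp K').Nonempty :=
    asupp_nonempty ((rcomponents_props V).2 K' (mem_coe.1 hK')).1 fun v hv => hne v (subset_of_mem_rcomponents (mem_coe.1 hK') hv)
  exact hK'ne.ne_empty hd

/-- `image` of `erase` under a map injective on the set. [folklore] -/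
private theorem image_erase_of_injOn {β γ : Type*} [DecidableEq β] [DecidableEq γ] {f : β → γ} {s : Finset β}
    (hf : Set.InjOn f s) {a : β} (ha : a ∈ s) : (s.erase a).image f = (s.image f).erase (f a) := by
  ext c
  simp only [mem_image, mem_erase]
  constructor
  · rintro ⟨b, ⟨hba, hb⟩, rfl⟩
    exact ⟨fun h => hba (hf hb ha h), b, hb, rfl⟩
  · rintro ⟨hc, b, hb, rfl⟩
    exact ⟨b, ⟨fun h => hc (h ▸ rfl), hb⟩, rfl⟩

omit [DecidableEq ι] in
/-- removing one component: the components of `V ∖ K` are the other components. [cite: BalabanImbrieJaffe1988, (5.14.5) p.312] -/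
theorem rcomponents_sdiff {V K : Finset α} (hK : K ∈ rcomponents (Ov isupp) V) :
    rcomponents (Ov isupp) (V \ K) = (rcomponents (Ov isupp) V).erase K := by
  obtain ⟨hcomp, hconn⟩ := rcomponents_props (isupp := isupp) V
  have hV : V \ K = ((rcomponents (Ov isupp) V).erase K).biUnion id := by
    ext v
    simp only [mem_sdiff, mem_biUnion, mem_erase, id]
    constructor
    · rintro ⟨hv, hvK⟩
      have hv' : v ∈ (rcomponents (Ov isupp) V).biUnion id := by rw [biUnion_rcomponents]; exact hv
      obtain ⟨K', hK', hvK'⟩ := mem_biUnion.1 hv'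
      exact ⟨K', ⟨fun h => hvK (h ▸ hvK'), hK'⟩, hvK'⟩
    · rintro ⟨K', ⟨hK'K, hK'⟩, hvK'⟩
      exact ⟨subset_of_mem_rcomponents hK' hvK', fun hvK => disjoint_left.1 (disjoint_of_compatible hcomp hK' hK hK'K) hvK' hvK⟩
  rw [hV]
  exact rcomponents_biUnion_eq (fun K' hK' => hconn K' (mem_of_mem_erase hK')) (hcomp.mono (erase_subset _ _))

omit [DecidableEq ι] in
/-- adding a connected set of items separated from `V` (no shared and no overlapping items) adds exactly one component.
[cite: BalabanImbrieJaffe1988, (5.14.5) p.312] -/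
theorem rcomponents_union_of_separated {V K : Finset α} (hKc : IsRConnected (Ov isupp) K)
    (hsep : ∀ v ∈ K, ∀ w ∈ V, v ≠ w ∧ ¬ Ov isupp v w) :
    rcomponents (Ov isupp) (K ∪ V) = insert K (rcomponents (Ov isupp) V) := by
  obtain ⟨hcomp, hconn⟩ := rcomponents_props (isupp := isupp) V
  have hKV : K ∉ rcomponents (Ov isupp) V := by
    intro hKm
    obtain ⟨v, hv⟩ := hKc.1
    exact (hsep v hv v (subset_of_mem_rcomponents hKm hv)).1 rfl
  have hV : K ∪ V = (insert K (rcomponents (Ov isupp) V)).biUnion id := by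
    rw [biUnion_insert, id, biUnion_rcomponents]
  rw [hV]
  refine rcomponents_biUnion_eq (fun K' hK' => ?_) ?_
  · rcases mem_insert.1 hK' with rfl | hK'
    · exact hKc
    · exact hconn K' hK'
  · -- compatibility of `insert K (components of V)`
    refine (isCompatible_insert (fun A B h => geomInc_symm _ ov_symm h) hKV).2 ⟨hcomp, fun K' hK' hinc => ?_⟩
    rcases hinc with rfl | ⟨v, hv, w, hw, hvw⟩
    · exact hKV hK'
    · have hwV : w ∈ V := subset_of_mem_rcomponents hK' hw
      rcases hvw with rfl | hvw
      · exact (hsep v hv v hwV).1 rfl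
      · exact (hsep v hv w hwV).2 hvw

/-! ## §2 Aggregates: the activity `G(X)` of a set of cubes and the slices of the sum -/

variable (isupp)

/-- the connected, admissible sets of items of `U` with support exactly `X` (p. 310 [PDF 54]: *"summing only over {X_γ}, (Y₁,…,Y_B) which fill X"*).
[cite: BalabanImbrieJaffe1988, (5.14.5) p.312] -/
def aggFiber (U : Finset α) (AdmLoc : Finset α → Prop) [DecidablePred AdmLoc] (X : Finset ι) : Finset (Finset α) := by
  classical exact U.powerset.filter fun K => IsRConnected (Ov isupp) K ∧ AdmLoc K ∧ asupp isupp K = X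

/-- **the activity of an aggregate**, `G(X) := Σ_{K ⊆ U connected, AdmLoc K, asupp K = X} Π_{v∈K} a v` (the shape of the printed `G_k(X_{r′})`, p. 312,
and of `W₆^{(k)′}(X)`, p. 310). [cite: BalabanImbrieJaffe1988, (5.14.5) p.312] -/
def aggWeight (U : Finset α) (AdmLoc : Finset α → Prop) [DecidablePred AdmLoc] (a : α → M) (X : Finset ι) : M :=
  ∑ K ∈ aggFiber isupp U AdmLoc X, ∏ v ∈ K, a v

/-- the slice of the configuration sum with prescribed family of component supports `ρ`: the sets `V ⊆ U` all of whose overlap-components satisfy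
`AdmLoc` and whose components have supports exactly the members of `ρ`. [cite: BalabanImbrieJaffe1988, (5.14.5) p.312] -/
def slice (U : Finset α) (AdmLoc : Finset α → Prop) [DecidablePred AdmLoc] (ρ : Finset (Finset ι)) : Finset (Finset α) :=
  U.powerset.filter fun V => (∀ K ∈ rcomponents (Ov isupp) V, AdmLoc K) ∧ (rcomponents (Ov isupp) V).image (asupp isupp) = ρ

variable {isupp} {U : Finset α} {AdmLoc : Finset α → Prop} [DecidablePred AdmLoc]

omit [DecidableEq α] in
/-- membership in `aggFiber`. [cite: BalabanImbrieJaffe1988, (5.14.5) p.312] -/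
theorem mem_aggFiber {X : Finset ι} {K : Finset α} :
    K ∈ aggFiber isupp U AdmLoc X ↔ K ⊆ U ∧ IsRConnected (Ov isupp) K ∧ AdmLoc K ∧ asupp isupp K = X := by
  classical
  unfold aggFiber
  simp only [mem_filter, mem_powerset]

/-- membership in `slice`. [cite: BalabanImbrieJaffe1988, (5.14.5) p.312] -/
theorem mem_slice {ρ : Finset (Finset ι)} {V : Finset α} :
    V ∈ slice isupp U AdmLoc ρ ↔
      V ⊆ U ∧ (∀ K ∈ rcomponents (Ov isupp) V, AdmLoc K) ∧ (rcomponents (Ov isupp) V).image (asupp isupp) = ρ := by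
  unfold slice
  simp only [mem_filter, mem_powerset]

omit [DecidableEq ι] in
/-- the empty set of items has no components. [cite: BalabanImbrieJaffe1988, (5.14.5) p.312] -/
theorem rcomponents_empty : rcomponents (Ov isupp) (∅ : Finset α) = ∅ := by
  unfold rcomponents; exact image_empty _

omit [DecidableEq ι] in
/-- a set of items without components is empty. [cite: BalabanImbrieJaffe1988, (5.14.5) p.312] -/
theorem eq_empty_of_rcomponents_eq_empty {V : Finset α} (h : rcomponents (Ov isupp) V = ∅) : V = ∅ := by
  rw [← biUnion_rcomponents (R := Ov isupp) V, h, biUnion_empty]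

/-- the slice over the empty family of supports is `{∅}`. [cite: BalabanImbrieJaffe1988, (5.14.5) p.312] -/
theorem slice_empty : slice isupp U AdmLoc ∅ = {∅} := by
  ext V
  rw [mem_slice, mem_singleton]
  constructor
  · rintro ⟨-, -, h⟩
    exact eq_empty_of_rcomponents_eq_empty (image_eq_empty.1 h)
  · rintro rfl
    refine ⟨empty_subset _, ?_, ?_⟩ <;> simp [rcomponents_empty]

/-! ## §3 The regrouping by components and supports -/

/-- **splitting off the component with a given support.** For `X ∉ ρ` and `X` disjoint from the members of `ρ`, the slice over `insert X ρ` is in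
bijection with `aggFiber X × slice ρ` via `V ↦ (the component with support X, the rest)`, and the product weight splits accordingly:
`Σ_{V ∈ slice (insert X ρ)} Π_{v∈V} a v = G(X) · Σ_{V ∈ slice ρ} Π_{v∈V} a v`. [cite: BalabanImbrieJaffe1988, (5.14.5) p.312] -/
theorem sum_slice_insert (hne : ∀ v ∈ U, (isupp v).Nonempty) (a : α → M) {X : Finset ι} {ρ : Finset (Finset ι)} (hX : X ∉ ρ)
    (hdisj : ∀ Y ∈ ρ, Disjoint X Y) :
    ∑ V ∈ slice isupp U AdmLoc (insert X ρ), ∏ v ∈ V, a v =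
      aggWeight isupp U AdmLoc a X * ∑ V ∈ slice isupp U AdmLoc ρ, ∏ v ∈ V, a v := by
  rw [aggWeight, sum_mul_sum, ← sum_product']
  symm
  refine sum_nbij (fun p => p.1 ∪ p.2) ?_ ?_ ?_ ?_
  · -- maps `aggFiber X × slice ρ` into `slice (insert X ρ)`
    rintro ⟨K, V₁⟩ hp
    obtain ⟨hK, hV₁⟩ := mem_product.1 hp
    obtain ⟨hKU, hKc, hKadm, hKX⟩ := mem_aggFiber.1 hK
    obtain ⟨hV₁U, hV₁adm, hV₁ρ⟩ := mem_slice.1 hV₁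
    have hsep : ∀ v ∈ K, ∀ w ∈ V₁, v ≠ w ∧ ¬ Ov isupp v w := by
      intro v hv w hw
      -- `w` lies in a component of `V₁`, whose support is in `ρ`, hence disjoint from `X ⊇ isupp v`
      have hw' : w ∈ (rcomponents (Ov isupp) V₁).biUnion id := by rw [biUnion_rcomponents]; exact hw
      obtain ⟨K', hK', hwK'⟩ := mem_biUnion.1 hw'
      have hK'ρ : asupp isupp K' ∈ ρ := hV₁ρ ▸ mem_image_of_mem _ hK'
      have hd : Disjoint (isupp v) (isupp w) :=
        (hdisj _ hK'ρ).mono (hKX ▸ isupp_subset_asupp hv) (isupp_subset_asupp hwK')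
      refine ⟨?_, fun h => h hd⟩
      rintro rfl
      obtain ⟨i, hi⟩ := hne v (hKU hv)
      exact disjoint_left.1 hd hi hi
    refine mem_slice.2 ⟨union_subset hKU hV₁U, ?_, ?_⟩
    · rw [rcomponents_union_of_separated hKc hsep]
      intro K' hK'
      rcases mem_insert.1 hK' with rfl | hK'
      · exact hKadm
      · exact hV₁adm K' hK'
    · rw [rcomponents_union_of_separated hKc hsep, image_insert, hKX, hV₁ρ]
  · -- injective
    rintro ⟨K, V₁⟩ hp ⟨K', V₁'⟩ hp' h
    simp only at h
    obtain ⟨hK, hV₁⟩ := mem_product.1 (mem_coe.1 hp)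
    obtain ⟨hK', hV₁'⟩ := mem_product.1 (mem_coe.1 hp')
    obtain ⟨hKU, hKc, -, hKX⟩ := mem_aggFiber.1 hK
    obtain ⟨hK'U, hK'c, -, hK'X⟩ := mem_aggFiber.1 hK'
    obtain ⟨-, -, hV₁ρ⟩ := mem_slice.1 hV₁
    obtain ⟨-, -, hV₁'ρ⟩ := mem_slice.1 hV₁'
    -- an item of `K` cannot lie in `V₁'` (its support is inside `X`, the supports of the components of `V₁'` are in `ρ`), and vice versa
    have key : ∀ {K₀ V₀ : Finset α}, asupp isupp K₀ = X → (rcomponents (Ov isupp) V₀).image (asupp isupp) = ρ → K₀ ⊆ U →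
        Disjoint K₀ V₀ := by
      intro K₀ V₀ hK₀X hV₀ρ hK₀U
      refine disjoint_left.2 fun v hvK hvV => ?_
      have hv' : v ∈ (rcomponents (Ov isupp) V₀).biUnion id := by rw [biUnion_rcomponents]; exact hvV
      obtain ⟨K₁, hK₁, hvK₁⟩ := mem_biUnion.1 hv'
      have hK₁ρ : asupp isupp K₁ ∈ ρ := hV₀ρ ▸ mem_image_of_mem _ hK₁
      have hd : Disjoint (isupp v) (isupp v) :=
        (hdisj _ hK₁ρ).mono (hK₀X ▸ isupp_subset_asupp hvK) (isupp_subset_asupp hvK₁)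
      obtain ⟨i, hi⟩ := hne v (hK₀U hvK)
      exact disjoint_left.1 hd hi hi
    have h1 : Disjoint K V₁ := key hKX hV₁ρ hKU
    have h2 : Disjoint K' V₁' := key hK'X hV₁'ρ hK'U
    have h3 : Disjoint K V₁' := key hKX hV₁'ρ hKU
    have h4 : Disjoint K' V₁ := key hK'X hV₁ρ hK'U
    have hKK' : K = K' := by
      ext v
      constructor
      · intro hv
        have : v ∈ K' ∪ V₁' := h ▸ mem_union_left _ hv
        rcases mem_union.1 this with h' | h'
        · exact h'
        · exact absurd h' (disjoint_left.1 h3 hv)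
      · intro hv
        have : v ∈ K ∪ V₁ := h.symm ▸ mem_union_left _ hv
        rcases mem_union.1 this with h' | h'
        · exact h'
        · exact absurd h' (disjoint_left.1 h4 hv)
    subst hKK'
    have hVV : V₁ = V₁' := by
      rw [← union_sdiff_cancel_left h1, ← union_sdiff_cancel_left h2, h]
    rw [hVV]
  · -- surjective
    intro V hV
    obtain ⟨hVU, hVadm, hVρ⟩ := mem_slice.1 (mem_coe.1 hV)
    obtain ⟨hcomp, hconn⟩ := rcomponents_props (isupp := isupp) V
    have hXm : X ∈ (rcomponents (Ov isupp) V).image (asupp isupp) := hVρ ▸ mem_insert_self X ρ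
    obtain ⟨K, hK, hKX⟩ := mem_image.1 hXm
    have hKV : K ⊆ V := subset_of_mem_rcomponents hK
    refine ⟨(K, V \ K), mem_coe.2 (mem_product.2 ⟨mem_aggFiber.2 ⟨hKV.trans hVU, hconn K hK, hVadm K hK, hKX⟩, mem_slice.2
      ⟨sdiff_subset.trans hVU, fun K' hK' => ?_, ?_⟩⟩), union_sdiff_of_subset hKV⟩
    · rw [rcomponents_sdiff hK] at hK'
      exact hVadm K' (mem_of_mem_erase hK')
    · rw [rcomponents_sdiff hK, image_erase_of_injOn (asupp_injOn_rcomponents fun v hv => hne v (hVU hv)) hK, hKX, hVρ, erase_insert hX]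
  · -- weights
    rintro ⟨K, V₁⟩ hp
    obtain ⟨hK, hV₁⟩ := mem_product.1 hp
    obtain ⟨hKU, -, -, hKX⟩ := mem_aggFiber.1 hK
    obtain ⟨-, -, hV₁ρ⟩ := mem_slice.1 hV₁
    have h1 : Disjoint K V₁ := by
      refine disjoint_left.2 fun v hvK hvV => ?_
      have hv' : v ∈ (rcomponents (Ov isupp) V₁).biUnion id := by rw [biUnion_rcomponents]; exact hvV
      obtain ⟨K₁, hK₁, hvK₁⟩ := mem_biUnion.1 hv'
      have hK₁ρ : asupp isupp K₁ ∈ ρ := hV₁ρ ▸ mem_image_of_mem _ hK₁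
      have hd : Disjoint (isupp v) (isupp v) :=
        (hdisj _ hK₁ρ).mono (hKX ▸ isupp_subset_asupp hvK) (isupp_subset_asupp hvK₁)
      obtain ⟨i, hi⟩ := hne v (hKU hvK)
      exact disjoint_left.1 hd hi hi
    simp only
    rw [prod_union h1]

/-- **the regrouping, one slice at a time** (p. 310 *"The connected components of G define a partition"*, p. 312 *"The X_{r′} are disjoint"*):
for a family `ρ` of pairwise disjoint sets of cubes, `Σ_{V ∈ slice ρ} Π_{v∈V} a v = Π_{X∈ρ} G(X)`.
[cite: BalabanImbrieJaffe1988, (5.14.5) p.312] -/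
theorem sum_slice_eq_prod_aggWeight (hne : ∀ v ∈ U, (isupp v).Nonempty) (a : α → M) (ρ : Finset (Finset ι))
    (hρ : (ρ : Set (Finset ι)).PairwiseDisjoint id) :
    ∑ V ∈ slice isupp U AdmLoc ρ, ∏ v ∈ V, a v = ∏ X ∈ ρ, aggWeight isupp U AdmLoc a X := by
  induction ρ using Finset.induction_on with
  | empty => rw [slice_empty, sum_singleton, prod_empty, prod_empty]
  | @insert X ρ hX ih =>
    have hρ' : (ρ : Set (Finset ι)).PairwiseDisjoint id := hρ.subset (coe_subset.2 (subset_insert _ _))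
    have hdisj : ∀ Y ∈ ρ, Disjoint X Y := fun Y hY =>
      hρ (mem_coe.2 (mem_insert_self X ρ)) (mem_coe.2 (mem_insert_of_mem hY)) (fun h => hX (h ▸ hY))
    rw [sum_slice_insert hne a hX hdisj, ih hρ', prod_insert hX]

variable (isupp) in
/-- the families of pairwise disjoint nonempty subsets of a set of cubes `W` (*"The X_{r′} are disjoint"*). [cite: BalabanImbrieJaffe1988, (5.14.5) p.312] -/
def disjFamilies (W : Finset ι) : Finset (Finset (Finset ι)) :=
  W.powerset.powerset.filter fun ρ => (∀ X ∈ ρ, X.Nonempty) ∧ ∀ X ∈ ρ, ∀ Y ∈ ρ, X ≠ Y → Disjoint X Y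

omit [DecidableEq α] in
/-- membership in `disjFamilies`. [cite: BalabanImbrieJaffe1988, (5.14.5) p.312] -/
theorem mem_disjFamilies {W : Finset ι} {ρ : Finset (Finset ι)} :
    ρ ∈ disjFamilies W ↔ (∀ X ∈ ρ, X ⊆ W) ∧ (∀ X ∈ ρ, X.Nonempty) ∧ (ρ : Set (Finset ι)).PairwiseDisjoint id := by
  unfold disjFamilies
  rw [mem_filter, mem_powerset]
  constructor
  · rintro ⟨h, hne, hd⟩
    exact ⟨fun X hX => mem_powerset.1 (h hX), hne, fun X hX Y hY hXY => hd X (mem_coe.1 hX) Y (mem_coe.1 hY) hXY⟩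
  · rintro ⟨h, hne, hd⟩
    exact ⟨fun X hX => mem_powerset.2 (h X hX), hne, fun X hX Y hY hXY => hd (mem_coe.2 hX) (mem_coe.2 hY) hXY⟩

/-- **the family of supports of the components of a set of items of `U` is a family of pairwise disjoint nonempty subsets of the support of `U`**
(*"The X_{r′} are disjoint"*, p. 312). [cite: BalabanImbrieJaffe1988, (5.14.5) p.312] -/
theorem image_asupp_mem_disjFamilies (hne : ∀ v ∈ U, (isupp v).Nonempty) {V : Finset α} (hV : V ⊆ U) :
    (rcomponents (Ov isupp) V).image (asupp isupp) ∈ disjFamilies (asupp isupp U) := by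
  obtain ⟨hcomp, hconn⟩ := rcomponents_props (isupp := isupp) V
  refine mem_disjFamilies.2 ⟨fun X hX => ?_, fun X hX => ?_, ?_⟩
  · obtain ⟨K, hK, rfl⟩ := mem_image.1 hX
    exact biUnion_subset_biUnion_of_subset_left isupp ((subset_of_mem_rcomponents hK).trans hV)
  · obtain ⟨K, hK, rfl⟩ := mem_image.1 hX
    exact asupp_nonempty (hconn K hK).1 fun v hv => hne v (hV (subset_of_mem_rcomponents hK hv))
  · intro X hX Y hY hXY
    obtain ⟨K, hK, rfl⟩ := mem_image.1 (mem_coe.1 hX)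
    obtain ⟨K', hK', rfl⟩ := mem_image.1 (mem_coe.1 hY)
    exact disjoint_asupp_of_compatible hcomp hK hK' fun h => hXY (h ▸ rfl)

/-- **the regrouped sum**: for any constraint `Φ` on the family of component supports,
`Σ_{V ⊆ U: every component satisfies AdmLoc, Φ(component supports)} Π_{v∈V} a v = Σ_{ρ ∈ disjFamilies(asupp U), Φ ρ} Π_{X∈ρ} G(X)` — the sum over
configurations of items becomes a sum over families of pairwise disjoint aggregates with factorized activities (p. 312: *"the result can be written
in the following form: … Σ_{{X_{r′}}} Π_{r′} G_k(X_{r′}) … The X_{r′} are disjoint"*). [cite: BalabanImbrieJaffe1988, (5.14.5) p.312] -/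
theorem sum_admLoc_eq_sum_disjFamilies (hne : ∀ v ∈ U, (isupp v).Nonempty) (a : α → M) (Φ : Finset (Finset ι) → Prop)
    [DecidablePred Φ] :
    ∑ V ∈ U.powerset with ((∀ K ∈ rcomponents (Ov isupp) V, AdmLoc K) ∧ Φ ((rcomponents (Ov isupp) V).image (asupp isupp))),
        ∏ v ∈ V, a v =
      ∑ ρ ∈ disjFamilies (asupp isupp U) with Φ ρ, ∏ X ∈ ρ, aggWeight isupp U AdmLoc a X := by
  rw [← sum_fiberwise_of_maps_to (g := fun V => (rcomponents (Ov isupp) V).image (asupp isupp))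
    (t := (disjFamilies (asupp isupp U)).filter Φ) (fun V hV => mem_filter.2
      ⟨image_asupp_mem_disjFamilies hne (mem_powerset.1 (mem_filter.1 hV).1), (mem_filter.1 hV).2.2⟩)]
  refine sum_congr rfl fun ρ hρ => ?_
  obtain ⟨hρd, hΦ⟩ := mem_filter.1 hρ
  rw [← sum_slice_eq_prod_aggWeight hne a ρ (mem_disjFamilies.1 hρd).2.2, filter_filter]
  refine sum_congr ?_ fun _ _ => rfl
  ext V
  rw [mem_filter, mem_slice, mem_powerset]
  constructor
  · rintro ⟨hVU, ⟨hadm, -⟩, hVρ⟩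
    exact ⟨hVU, hadm, hVρ⟩
  · rintro ⟨hVU, hadm, hVρ⟩
    exact ⟨hVU, ⟨hadm, hVρ ▸ hΦ⟩, hVρ⟩

end Literature.MathematicalPhysics.QuantumFieldTheory.BalabanImbrieJaffe1984to88.BIJ88SupportRegrouping312
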